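import Literature.NumberTheory.EllipticCurves.Kato2004.ColemanMapAdmissibleZeta
import Literature.NumberTheory.EllipticCurves.GaloisAction
import HarnessLib

/-!
# Route `DerivedKatoValuationDoor`, crux `DerivedKatoDoor` (stmt-BirchSwinnertonDyer-23024), line `birth`
# (skeleton `Cruxes/DerivedKatoDoor/Lines/birth.lean`, r2 sha16 b5fa204f5044): registered stub
# `stub_sandwichFromDA` — the UPPER SANDWICH «(D-A₂ ∧ Loc_p) ⇒ D-K₂ at door primes» REDUCED, kernel-checked,
# to TWO print facts of `Literature/NumberTheory/EllipticCurves/Kato2004/ColemanMapAdmissibleZeta.lean`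
# (stub worker `bsd-line-dkd-w2`; `--supports stmt-BirchSwinnertonDyer-23024`; namespace
# `…Theorems.DerivedKatoValuationDoor`)

WHAT. `stub_sandwichFromDA_of_facts`: ASSUMING the two Literature named facts
`Kato2004.exists_colemanMap_admissibleZeta` (Rubin 1998 Durham Thm. 6.1/7.1/Cor. 7.2 (ii)/Prop. A.2 = Kato
2004 Thm. 16.4 (ii)/16.6 (2)/Prop. 17.11 = Burns–Kurihara–Sano Thm. 6.10 + Lemma 6.14: a `Λ`-linear
`L = Col ∘ loc_p : 𝐇¹ → Λ` with `ord_T L(z₀) = ord_T L_p(f,α)` for every admissible `z₀` and `L(h)(𝟙) = 0`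
whenever `h(𝟙)` is Kummer at `p`) and `Kato2004.hasLocPKummerLog_of_exists_log_ne_zero` (Kurihara–Pollack
2007 Lemma 1.4: the global image in `H¹(ℚ_p, V_pE)` is a line, so ONE global class of non-zero Kummer
logarithm makes EVERY global class Kummer at `p`), the registered signature of `stub_sandwichFromDA` holds
VERBATIM: at a door prime (`5 ≤ p`, good ordinary, `ρ̄_{E,p}` onto), `ρ_p = ord_T L_p(f, α_p) ≤ 2` for every
newform `f` of `W` together with `Loc_p` (an integral global class of non-zero Kummer logarithm at `p`)
force `v_T(z₀) ≤ 1` for every admissible Kato zeta class `z₀` of every pinned `𝐇¹_Γ(T_pW)`: no `p^m • z₀`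
lies in `T² • 𝐇¹`.

PROOF (the line card's chain, 15 lines of kernel algebra in `Λ = ℤ_p⟦T⟧`). Suppose `p^m • z₀ = T² • h`.
The admissible class carries a newform `f` of `W` (first witnesses of `IsAdmissibleZetaClass`). Apply `L`:
`p^m · L(z₀) = T² · L(h)` in the domain `ℤ_p⟦T⟧`, so `ord_T L(z₀) = 2 + ord_T L(h)` (`ord_T p^m = 0`); by
(C2) and D-A₂, `ord_T L(z₀) = ρ_p ≤ 2`, hence `ord_T L(h) = 0`, i.e. `L(h)(𝟙) ≠ 0`. But `Loc_p` and the
Kurihara–Pollack line make the bottom layer `h(𝟙)` Kummer at `p`, so (C3) gives `L(h)(𝟙) = 0` —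
contradiction. (`a = 2` is not used: the sandwich holds at every door prime.)

HONEST FRAMING. This file does NOT close the stub unconditionally: the two hypotheses are unproved
Literature named facts (D-0014; sizes XL / L — Perrin-Riou's big dual exponential, Poitou–Tate for
`T_pE`), so the reduction is CONDITIONAL and the lead may reshape the skeleton to carry them as named
print stubs («closed modulo `exists_colemanMap_admissibleZeta`, `hasLocPKummerLog_of_exists_log_ne_zero`»).
Nothing here is a restatement of the crux: the crux `DerivedKatoDoor` additionally needs the OPEN stubs
`stub_ordLeTwoOfAnalyticRankTwo` (MTT order conjecture at `a = 2`) and `stub_locPOfAnalyticRankTwo`.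
BSD is not proved by any of this.

References: K. Rubin, *Euler systems and modular elliptic curves* (Durham 1996), LMS LN 254 (1998),
Thm. 6.1, Thm. 7.1, Cor. 7.2, Prop. A.2 [Rubin1998Durham]; K. Kato, Astérisque 295 (2004), Thm. 16.4,
Thm. 16.6, Prop. 17.11 [Kato2004Asterisque]; D. Burns, M. Kurihara, T. Sano, arXiv:1910.07404, §6.3–6.4
[BurnsKuriharaSano2019]; M. Kurihara, R. Pollack, LMS LN 320 (2007), Lemma 1.4 [KuriharaPollack2007];
S. Bloch, K. Kato (1990), Prop. 3.8, Ex. 3.11 [BlochKato1990].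
-/

-- D-0017: single-problem summit, so `Summit.BirchSwinnertonDyer.BirchSwinnertonDyer.…` repeats a
-- namespace BY DESIGN.
set_option linter.dupNamespace false

noncomputable section

open scoped Classical

namespace Summit.BirchSwinnertonDyer.BirchSwinnertonDyer.Theorems.DerivedKatoValuationDoor

open Field CongruenceSubgroup
open Literature.NumberTheory.GaloisRepresentations
open Literature.NumberTheory.EllipticCurves Literature.NumberTheory.EllipticCurves.ModularForms
open Literature.NumberTheory.EllipticCurves.Kato2004
open Literature.NumberTheory.EllipticCurves.Kato2004.EulerSystemValues (tateRep)

/-- **The constant `p^m ∈ Λ = ℤ_p⟦T⟧` has `T`-order `0`** (`p^m = monomial 0 (p^m)` with `p^m ≠ 0` in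
`ℤ_p`). Kernel. [cite: Washington1997, §7.1 (the Iwasawa algebra `ℤ_p⟦T⟧`)] -/
theorem order_natCast_prime_pow (p : ℕ) [Fact p.Prime] (m : ℕ) :
    (((p : IwasawaAlgebra p) ^ m)).order = 0 := by
  have hC : ((p : IwasawaAlgebra p) ^ m) = PowerSeries.monomial 0 ((p : ℤ_[p]) ^ m) := by
    rw [PowerSeries.monomial_zero_eq_C_apply, map_pow, map_natCast]
  rw [hC, PowerSeries.order_monomial_of_ne_zero]
  · rfl
  · exact pow_ne_zero m (by exact_mod_cast (Fact.out : p.Prime).ne_zero)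

/-- **A power series of `T`-order `0` has non-zero constant coefficient** (its lowest non-zero
coefficient sits in degree `ord_T = 0`). Kernel. [folklore] -/
theorem constantCoeff_ne_zero_of_order_eq_zero {R : Type*} [Semiring R] {φ : PowerSeries R}
    (h : φ.order = 0) : PowerSeries.constantCoeff φ ≠ 0 := by
  have hφ : φ ≠ 0 := by
    intro h0
    rw [h0, PowerSeries.order_zero] at h
    exact ENat.top_ne_zero h
  have hc := PowerSeries.coeff_order hφ
  rw [h, ENat.toNat_zero, PowerSeries.coeff_zero_eq_constantCoeff] at hc
  exact hc

/-- **Stub `stub_sandwichFromDA` of line `birth` (crux `DerivedKatoDoor`, stmt-BirchSwinnertonDyer-23024),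
REDUCED TO PRINT: the upper sandwich «(D-A₂ ∧ Loc_p) ⇒ D-K₂ at door primes» from the two Literature named
facts `exists_colemanMap_admissibleZeta` (Rubin 1998 / Kato 16.4 (ii), 16.6 (2), 17.11 / BKS Thm. 6.10 +
Lemma 6.14: the ordinary Coleman map `L = Col ∘ loc_p` on the pinned `𝐇¹`, `ord_T L(z₀) = ρ_p` for
admissible `z₀`, `L(h)(𝟙) = 0` when `h(𝟙)` is Kummer at `p`) and `hasLocPKummerLog_of_exists_log_ne_zero`
(Kurihara–Pollack Lemma 1.4: the global image in `H¹(ℚ_p,V_pE)` is a line).** The conclusion is the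
REGISTERED signature of `stub_sandwichFromDA` verbatim: for `W/ℚ` globally minimal elliptic and a door
prime `p` (`5 ≤ p`, good ordinary, `ρ̄_{E,p}` onto), if `ord_{T=0} L_p(f, α_p; T) ≤ 2` for every newform `f`
of `W` and some integral global class has non-zero Kummer logarithm at `p`, then for every cyclotomic
`ℤ_p`-extension `K`, topological generator `γ`, pinned `I : IwasawaH1Data W p K γ` and every ADMISSIBLE
Kato zeta class `z₀ ∈ I.H`, no `p^m • z₀` lies in `T² • I.H` (`v_T(z₀) ≤ 1`). Proof: `p^m • z₀ = T² • h`
gives `p^m·L(z₀) = T²·L(h)` in the domain `ℤ_p⟦T⟧`, so `ρ_p = ord_T L(z₀) = 2 + ord_T L(h) ≤ 2`, whence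
`L(h)(𝟙) ≠ 0`; but the line at `p` through the `Loc_p` class is `H¹_f`, so `h(𝟙)` is Kummer at `p` and
`L(h)(𝟙) = 0`. CONDITIONAL on the two named facts (unproved, D-0014); `a = 2` is not needed.
[cite: Rubin1998Durham, Thm. 6.1, Thm. 7.1, Cor. 7.2 (ii), Prop. A.2]
[cite: Kato2004Asterisque, Thm. 16.4 (ii) (p. 270), Thm. 16.6 (p. 271), Prop. 17.11 (p. 277)]
[cite: BurnsKuriharaSano2019, §6.3 Thm. 6.10, §6.4.1 Lemma 6.12–6.14]
[cite: KuriharaPollack2007, §1.4 Lemma 1.4] [cite: BlochKato1990, Prop. 3.8 and Ex. 3.11] -/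
theorem stub_sandwichFromDA_of_facts
    (hC : exists_colemanMap_admissibleZeta) (hKP : hasLocPKummerLog_of_exists_log_ne_zero) :
    ∀ (W : WeierstrassCurve ℚ) [W.IsElliptic] [W.IsGloballyMinimal] (p : ℕ) [Fact p.Prime]
      [ContinuousSMul ℤ_[p] (W.tateModule p)],
      (5 ≤ p ∧ Literature.NumberTheory.EllipticCurves.IsOrdinaryAt W p ∧ W.HasSurjectiveModNGaloisRep p) →
      ((∀ {N : ℕ} [NeZero N] (f : CuspForm (CongruenceSubgroup.Gamma0 N) 2),
          Literature.NumberTheory.EllipticCurves.ModularForms.IsNewformOf W f →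
            (Literature.NumberTheory.EllipticCurves.padicLFunction f
              (Literature.NumberTheory.EllipticCurves.unitRoot W p : ℚ_[p])).order ≤ 2) ∧
        (∃ (x : Literature.NumberTheory.GaloisRepresentations.H1
            (Literature.NumberTheory.EllipticCurves.Kato2004.EulerSystemValues.tateRep W p) ⊤) (t : ℚ_[p]),
          x ∈ Literature.NumberTheory.EllipticCurves.Kato2004.integralH1
              (Literature.NumberTheory.EllipticCurves.Kato2004.EulerSystemValues.tateRep W p) p ⊤ ∧
            t ≠ 0 ∧ Literature.NumberTheory.EllipticCurves.Kato2004.HasLocPKummerLog W p x t)) →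
      ∀ (K : Literature.NumberTheory.EllipticCurves.ZpExtension ℚ p) (hK : K.IsCyclotomic)
        (γ : Field.absoluteGaloisGroup ℚ)
        (I : Literature.NumberTheory.EllipticCurves.Kato2004.IwasawaH1Data W p K γ) (z₀ : I.H),
        K.IsTopGenerator γ →
        Literature.NumberTheory.EllipticCurves.Kato2004.IsAdmissibleZetaClass W p K hK I z₀ →
          ¬ ∃ (h : I.H) (m : ℕ),
            ((p : Literature.NumberTheory.EllipticCurves.IwasawaAlgebra p) ^ m) • z₀ =
              ((PowerSeries.X : Literature.NumberTheory.EllipticCurves.IwasawaAlgebra p) ^ 2) • h := by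
  intro W _ _ p _ _ hdoor hDA K hK γ I z₀ hγ hz hdiv
  obtain ⟨h, m, hhm⟩ := hdiv
  obtain ⟨h5, hord, hsurj⟩ := hdoor
  obtain ⟨hcap, x, t, -, ht, hxt⟩ := hDA
  -- the newform carried by the admissible class (first witnesses of `IsAdmissibleZetaClass`)
  have hz' := hz
  obtain ⟨-, N, hN, f, hf, -⟩ := hz'
  -- (C1): the Coleman map `L = Col ∘ loc_p` on the pinned `𝐇¹`
  obtain ⟨L, hLord, hLval⟩ := hC W p h5 hord hsurj f hf K hK γ hγ I
  -- (C2) with D-A₂: `ord_T L(z₀) = ρ_p ≤ 2`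
  have hρ : (L z₀).order ≤ 2 := (hLord z₀ hz).le.trans (hcap f hf)
  -- apply `L` to `p^m • z₀ = T² • h`
  have hrel : ((p : IwasawaAlgebra p) ^ m) * L z₀ = (PowerSeries.X : IwasawaAlgebra p) ^ 2 * L h := by
    have e := congrArg L hhm
    simpa only [map_smul, smul_eq_mul] using e
  -- orders in the domain `ℤ_p⟦T⟧`: `0 + ord_T L(z₀) = 2 + ord_T L(h)`
  have hordeq : (L z₀).order = 2 + (L h).order := by
    have e := congrArg PowerSeries.order hrel
    rwa [PowerSeries.order_mul, PowerSeries.order_mul, order_natCast_prime_pow, zero_add,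
      PowerSeries.order_X_pow] at e
  have hLh : (L h).order = 0 := by
    have h2 : (2 : ℕ∞) + (L h).order ≤ 2 + 0 := by rw [add_zero, ← hordeq]; exact hρ
    exact nonpos_iff_eq_zero.mp ((ENat.add_le_add_iff_left (by decide)).mp h2)
  -- (KP) with `Loc_p`: the bottom layer of `h` is Kummer at `p`; then (C3): `L(h)(𝟙) = 0`
  have hkum : ∃ t' : ℚ_[p], HasLocPKummerLog W p (layerZeroToTop W p K (I.proj 0 h)) t' :=
    hKP W p ⟨x, t, ht, hxt⟩ _
  exact constantCoeff_ne_zero_of_order_eq_zero hLh (hLval h hkum)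

end Summit.BirchSwinnertonDyer.BirchSwinnertonDyer.Theorems.DerivedKatoValuationDoor

end
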